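import Literature.Analysis.FluidPDE.TaoAveragedEulerFormBound
import Literature.Analysis.FunctionSpaces.FourierSobolevNormEmbeddingProofs

/-!
# Route PerpetualPump · `EulerTypeIGlue` — toolkit I: `𝓕L¹ ⊂ L^∞` for `L²` classes and the
# embedding `H¹⁰(ℝ³) ⊂ L^∞`

Support file for the support item `EulerTypeIGlue` (stmt-NavierStokesRegularity-1838) of route
PerpetualPump. In Tao's `H¹⁰_df` setting (`Literature/Analysis/FluidPDE/TaoAveragedSobolev.lean`)
the Fourier transform is Mathlib's Plancherel isometry of `L²(E; F)`; on `L¹ ∩ L²` it is the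
Fourier integral (tree: `Literature.Analysis.FunctionSpaces.fourier_toLp_ae_eq_fourierIntegral`,
`…SobolevEmbeddingHalf.fourierInv_toLp_ae_eq_fourierIntegralInv`). Consequences recorded here: an
`L²` class whose transform is integrable is a.e. the inverse Fourier integral of its transform
(`coeFn_ae_eq_fourierInv`), hence essentially bounded by `‖𝓕f‖₁`, and the embedding
`‖w‖_{L^∞} ≤ (∫(1+|ξ|²)^{-10})^{1/2} ‖w‖_{H¹⁰}` on `L²(ℝ³; ℂ³)` (`H¹⁰ ⊂ 𝓕L¹`, the tree's
`Tao2016.lintegral_enorm_le_sobolevWeight`).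

## References

* E. M. Stein, G. Weiss, *Introduction to Fourier Analysis on Euclidean Spaces* (1971), Ch. I,
  Thm. 2.3 (Plancherel; the `L²` transform agrees with the integral on `L¹ ∩ L²`).
* T. Tao, J. Amer. Math. Soc. 29 (2016), arXiv:1402.0290v3, §1.1 (`H¹⁰_df`). [Tao2016AveragedNS]
-/

noncomputable section

open MeasureTheory Set Filter Topology FourierTransform SchwartzMap
open scoped ENNReal NNReal FourierTransform RealInnerProductSpace ContDiff

set_option linter.dupNamespace false

namespace Summit.NavierStokesRegularity.NavierStokesRegularity.Theorems.PerpetualPumpEulerTypeIGlue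

section General

variable {V : Type*} [NormedAddCommGroup V] [InnerProductSpace ℝ V] [FiniteDimensional ℝ V]
  [MeasurableSpace V] [BorelSpace V]
variable {F : Type*} [NormedAddCommGroup F] [InnerProductSpace ℂ F] [CompleteSpace F]

/-- An `L²` class whose `L²` Fourier transform has an integrable representative is a.e. the
inverse Fourier integral of that representative. [folklore] -/
theorem coeFn_ae_eq_fourierInv (f : Lp F 2 (volume : Measure V))
    (hint : Integrable ((𝓕 f : Lp F 2 (volume : Measure V)) : V → F)) :
    (f : V → F) =ᵐ[volume] 𝓕⁻ ((𝓕 f : Lp F 2 (volume : Measure V)) : V → F) := by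
  set G : V → F := ((𝓕 f : Lp F 2 (volume : Measure V)) : V → F) with hG
  have hG2 : MemLp G 2 volume := Lp.memLp _
  have hGf : hG2.toLp G = (𝓕 f : Lp F 2 (volume : Measure V)) := Lp.toLp_coeFn _ hG2
  have hf : f = 𝓕⁻ (hG2.toLp G) := by rw [hGf, fourierInv_fourier_eq]
  have h := Literature.Analysis.FunctionSpaces.SobolevEmbeddingHalf.fourierInv_toLp_ae_eq_fourierIntegralInv
    hint hG2
  rw [← hf] at h
  exact h

/-- **`𝓕L¹ ⊂ L^∞`**: if the `L²` Fourier transform of `f ∈ L²` is integrable then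
`‖f‖_{L^∞} ≤ ‖𝓕 f‖_{L¹}`. [folklore] -/
theorem eLpNorm_top_le_lintegral_enorm_fourier (f : Lp F 2 (volume : Measure V))
    (hint : Integrable ((𝓕 f : Lp F 2 (volume : Measure V)) : V → F)) :
    eLpNorm (f : V → F) ⊤ volume ≤ ∫⁻ ξ, ‖((𝓕 f : Lp F 2 (volume : Measure V)) : V → F) ξ‖ₑ := by
  rw [eLpNorm_congr_ae (coeFn_ae_eq_fourierInv f hint), eLpNorm_exponent_top,
    ← ofReal_integral_norm_eq_lintegral_enorm hint]
  exact eLpNormEssSup_le_of_ae_bound (Eventually.of_forall fun x =>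
    Literature.Analysis.FunctionSpaces.SobolevEmbeddingHalf.norm_fourierIntegralInv_le_integral_norm _ x)

end General

/-! ### `H¹⁰(ℝ³; ℂ³) ⊂ L^∞` -/

open Literature.Analysis.FluidPDE.Tao2016

/-- The constant `(∫_{ℝ³} (1+|ξ|²)^{-10} dξ)^{1/2}` is positive. [folklore] -/
theorem sobolevTen_const_pos :
    0 < (∫⁻ ξ : EuclideanSpace ℝ (Fin 3), ENNReal.ofReal ((1 + ‖ξ‖ ^ 2) ^ (-10 : ℝ))) ^ (1 / 2 : ℝ) := by
  refine ENNReal.rpow_pos ?_ lintegral_inv_sobolevWeight_lt_top.ne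
  refine (lintegral_pos_iff_support (measurable_sobolevWeight (-10))).2 ?_
  have hsupp : Function.support (fun ξ : EuclideanSpace ℝ (Fin 3) =>
      ENNReal.ofReal ((1 + ‖ξ‖ ^ 2) ^ (-10 : ℝ))) = Set.univ := by
    ext ξ
    simp only [Function.mem_support, ne_eq, ENNReal.ofReal_eq_zero, not_le, Set.mem_univ, iff_true]
    positivity
  rw [hsupp]
  simp

/-- **`H¹⁰(ℝ³) ⊂ L^∞`**, quantitatively, on `L²(ℝ³; ℂ³)`:
`‖w‖_{L^∞} ≤ (∫ (1+|ξ|²)^{-10})^{1/2} ‖w‖_{H¹⁰}` (Cauchy–Schwarz on the Fourier side gives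
`ŵ ∈ L¹`, and `w = 𝓕⁻¹ ŵ` is bounded by `‖ŵ‖₁`). [cite: Tao2016AveragedNS, §1.1 (H¹⁰ ⊂ 𝓕L¹, p. 3)] -/
theorem eLpNorm_top_le_sobolevTen (w : L2C) :
    eLpNorm (w : EuclideanSpace ℝ (Fin 3) → EuclideanSpace ℂ (Fin 3)) ⊤ volume ≤
      (∫⁻ ξ : EuclideanSpace ℝ (Fin 3), ENNReal.ofReal ((1 + ‖ξ‖ ^ 2) ^ (-10 : ℝ))) ^ (1 / 2 : ℝ) *
        Literature.Analysis.FunctionSpaces.eFourierSobolevNorm 10 w := by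
  set K : ℝ≥0∞ := (∫⁻ ξ : EuclideanSpace ℝ (Fin 3),
    ENNReal.ofReal ((1 + ‖ξ‖ ^ 2) ^ (-10 : ℝ))) ^ (1 / 2 : ℝ) with hK
  by_cases hfin : Literature.Analysis.FunctionSpaces.eFourierSobolevNorm 10 w < ⊤
  · -- `ŵ ∈ L¹`
    have hL1 : ∫⁻ ξ, ‖fourierFn w ξ‖ₑ ≤ K * Literature.Analysis.FunctionSpaces.eFourierSobolevNorm 10 w := by
      have h := lintegral_enorm_le_sobolevWeight (f := fourierFn w) (aestronglyMeasurable_fourierFn w)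
      rwa [← eFourierSobolevNorm_eq] at h
    have hint : Integrable (fourierFn w) volume :=
      ⟨aestronglyMeasurable_fourierFn w,
        lt_of_le_of_lt hL1 (ENNReal.mul_lt_top
          (ENNReal.rpow_lt_top_of_nonneg (by norm_num) lintegral_inv_sobolevWeight_lt_top.ne) hfin)⟩
    exact (eLpNorm_top_le_lintegral_enorm_fourier w hint).trans hL1
  · rw [not_lt, top_le_iff] at hfin
    rw [hfin, ENNReal.mul_top sobolevTen_const_pos.ne']
    exact le_top

end Summit.NavierStokesRegularity.NavierStokesRegularity.Theorems.PerpetualPumpEulerTypeIGlue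

end
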